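import Literature.Computability.Complexity.GraphCanonizationProgramRefine
import Literature.Computability.Complexity.CodeFPBudgets
import Literature.Computability.Complexity.CodeFPStrings
import HarnessLib

/-!
# The canoniser as a list program is typed polynomial time, I: one round of colour refinement

`CodeFP` certificates (`CodeFP.lean`: maps computed on codes by `FP` string functions) for the
refinement round of `GraphCanonizationProgramRefine.lean` (`CGProg.ocrStepL`), staged through the
neighbour-count TABLE so that every inner test is a table lookup:

* `CGProg.cntTable` (`T[v][w] =` the neighbours of `v` of the colour of `w` in the state graph),
  `profLTT`, `keyLTT`, `ocrStepT` — the round read off the table; `ocrStepT_cntTable` — it is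
  `ocrStepL`;
* `codeFP_nbrCountL`, `codeFP_cntTable`, `codeFP_keyLTT`, `codeFP_ocrStepT`, **`codeFP_ocrStepL`** —
  all typed polynomial time on the context `((1ⁿ, rows, mask), colours)` (`CGProg.ctxE`).

## References

* S. Arora, B. Barak, *Computational Complexity: A Modern Approach*, CUP 2009, §1.3. [AroraBarakCC2009]
* J.-Y. Cai, M. Fürer, N. Immerman, Combinatorica 12 (1992), §5. [CaiFurerImmerman1992]
-/

namespace Literature.Computability.Complexity

open _root_.Computability CodeFP

namespace CGProg

/-! ### The staged round -/

/-- The context of the refinement programs: `((n in unary, adjacency rows, mask), colours)`. [folklore] -/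
abbrev Ctx : Type := (ℕ × (List (List Bool) × List Bool)) × List ℕ

/-- Its code. [folklore] -/
abbrev ctxE : Ctx → List Bool := pairE (pairE unE (pairE (rawE strE) strE)) (rawE natE)

/-- The neighbour-count table `T[v][w] = nbrCountL v (colour of w)`. [cite: CaiFurerImmerman1992, §5] -/
def cntTable (n : ℕ) (A : List (List Bool)) (mask : List Bool) (col : List ℕ) : List (List ℕ) :=
  (List.range n).map fun v => (List.range n).map fun w => nbrCountL n A mask col v (natAt col w)

/-- Table lookup. [folklore] -/
def tAt (T : List (List ℕ)) (v w : ℕ) : ℕ := natAt (T.getD v []) w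

/-- `ProfLT` read off the table. [cite: CaiFurerImmerman1992, §5] -/
def profLTT (n : ℕ) (col : List ℕ) (T : List (List ℕ)) (v u : ℕ) : Bool :=
  (List.range n).any fun w => decide (tAt T v w < tAt T u w) &&
    (List.range n).all fun w' => !decide (natAt col w' < natAt col w) || decide (tAt T v w' = tAt T u w')

/-- `KeyLT` read off the table. [cite: CaiFurerImmerman1992, §5] -/
def keyLTT (n : ℕ) (col : List ℕ) (T : List (List ℕ)) (v u : ℕ) : Bool :=
  decide (natAt col v < natAt col u) || (decide (natAt col v = natAt col u) && profLTT n col T v u)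

/-- The round read off the table. [cite: CaiFurerImmerman1992, §5] -/
def ocrStepT (n : ℕ) (col : List ℕ) (T : List (List ℕ)) : List ℕ :=
  (List.range n).map fun u => ((List.range n).filter fun v => keyLTT n col T v u).length

/-- Entries of the table. [folklore] -/
theorem tAt_cntTable (n : ℕ) (A : List (List Bool)) (mask : List Bool) (col : List ℕ) {v w : ℕ} (hv : v < n) (hw : w < n) :
    tAt (cntTable n A mask col) v w = nbrCountL n A mask col v (natAt col w) := by
  unfold tAt cntTable natAt
  simp [List.getD_eq_getElem?_getD, List.getElem?_range hv, List.getElem?_range hw]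

/-- `any` over a range depends only on the values on the range. [folklore] -/
theorem any_range_congr {n : ℕ} {p q : ℕ → Bool} (h : ∀ i < n, p i = q i) : (List.range n).any p = (List.range n).any q := by
  rw [Bool.eq_iff_iff, List.any_eq_true, List.any_eq_true]
  exact exists_congr fun i => and_congr_right fun hi => by rw [h i (List.mem_range.1 hi)]

/-- `all` over a range depends only on the values on the range. [folklore] -/
theorem all_range_congr {n : ℕ} {p q : ℕ → Bool} (h : ∀ i < n, p i = q i) : (List.range n).all p = (List.range n).all q := by
  rw [Bool.eq_iff_iff, List.all_eq_true, List.all_eq_true]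
  exact forall₂_congr fun i hi => by rw [h i (List.mem_range.1 hi)]

/-- `filter` over a range depends only on the values on the range. [folklore] -/
theorem filter_range_congr {n : ℕ} {p q : ℕ → Bool} (h : ∀ i < n, p i = q i) : (List.range n).filter p = (List.range n).filter q :=
  List.filter_congr fun i hi => h i (List.mem_range.1 hi)

/-- The staged key test is the direct one. [folklore] -/
theorem keyLTT_cntTable (n : ℕ) (A : List (List Bool)) (mask : List Bool) (col : List ℕ) {v u : ℕ} (hv : v < n) (hu : u < n) :
    keyLTT n col (cntTable n A mask col) v u = keyLTL n A mask col v u := by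
  unfold keyLTT keyLTL profLTT profLTL
  congr 2
  refine any_range_congr fun w hw => ?_
  rw [tAt_cntTable n A mask col hv hw, tAt_cntTable n A mask col hu hw]
  congr 1
  refine all_range_congr fun w' hw' => ?_
  rw [tAt_cntTable n A mask col hv hw', tAt_cntTable n A mask col hu hw']

/-- **The staged round is `ocrStepL`.** [folklore] -/
theorem ocrStepT_cntTable (n : ℕ) (A : List (List Bool)) (mask : List Bool) (col : List ℕ) :
    ocrStepT n col (cntTable n A mask col) = ocrStepL n A mask col := by
  unfold ocrStepT ocrStepL
  refine List.map_congr_left fun u hu => ?_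
  rw [filter_range_congr fun v hv => keyLTT_cntTable n A mask col hv (List.mem_range.1 hu)]

/-! ### Certificates -/

/-- Reading a bit of a mask at a binary index is typed polynomial time. [folklore] -/
theorem codeFP_bitAt : CodeFP (pairE strE natE) bitE (fun p => bitAt p.1 p.2) := strGetDNat

/-- Reading a numeral of a colour list at a binary index is typed polynomial time. [folklore] -/
theorem codeFP_natAt : CodeFP (pairE (rawE natE) natE) natE (fun p => natAt p.1 p.2) := rawGetD natE (d := 0) natE_zero

/-- Reading an adjacency entry is typed polynomial time. [folklore] -/
theorem codeFP_adjAt : CodeFP (pairE (rawE strE) (pairE natE natE)) bitE (fun p => adjAt p.1 p.2.1 p.2.2) :=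
  (strGetDNat.comp (((rawGetD strE (d := []) rfl).comp ((fst _ _).pair (snd _ _).fst')).pair (snd _ _).snd')).congr fun _ => rfl

/-- Adjacency within the mask is typed polynomial time: input `((rows, mask), (u, v))`. [folklore] -/
theorem codeFP_adjW : CodeFP (pairE (pairE (rawE strE) strE) (pairE natE natE)) bitE (fun p => adjW p.1.1 p.1.2 p.2.1 p.2.2) := by
  let κ : (List (List Bool) × List Bool) × (ℕ × ℕ) → List Bool := pairE (pairE (rawE strE) strE) (pairE natE natE)
  have hA : CodeFP κ (rawE strE) (fun t => t.1.1) := (fst _ _).fst'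
  have hm : CodeFP κ strE (fun t => t.1.2) := (fst _ _).snd'
  have hu : CodeFP κ natE (fun t => t.2.1) := (snd _ _).fst'
  have hv : CodeFP κ natE (fun t => t.2.2) := (snd _ _).snd'
  have h1 : CodeFP κ bitE (fun t => bitAt t.1.2 t.2.1) := (codeFP_bitAt.comp (hm.pair hu)).congr fun _ => rfl
  have h2 : CodeFP κ bitE (fun t => bitAt t.1.2 t.2.2) := (codeFP_bitAt.comp (hm.pair hv)).congr fun _ => rfl
  have h3 : CodeFP κ bitE (fun t => adjAt t.1.1 t.2.1 t.2.2) := (codeFP_adjAt.comp (hA.pair (hu.pair hv))).congr fun _ => rfl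
  exact ((h1.and h2).and h3).congr fun t => by simp only [adjW, Bool.and_assoc]

/-- **Neighbour counts are typed polynomial time**: input `(ctx, (v, a))`. [cite: AroraBarakCC2009, §1.3] -/
theorem codeFP_nbrCountL : CodeFP (pairE ctxE (pairE natE natE)) natE (fun t => nbrCountL t.1.1.1 t.1.1.2.1 t.1.1.2.2 t.1.2 t.2.1 t.2.2) := by
  -- the predicate on `((ctx, (v, a)), w)`
  let κ : (Ctx × (ℕ × ℕ)) × ℕ → List Bool := pairE (pairE ctxE (pairE natE natE)) natE
  have hA : CodeFP κ (rawE strE) (fun t => t.1.1.1.2.1) := (fst _ _).fst'.fst'.snd'.fst'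
  have hm : CodeFP κ strE (fun t => t.1.1.1.2.2) := (fst _ _).fst'.fst'.snd'.snd'
  have hcol : CodeFP κ (rawE natE) (fun t => t.1.1.2) := (fst _ _).fst'.snd'
  have hv : CodeFP κ natE (fun t => t.1.2.1) := (fst _ _).snd'.fst'
  have ha : CodeFP κ natE (fun t => t.1.2.2) := (fst _ _).snd'.snd'
  have hw : CodeFP κ natE (fun t => t.2) := snd _ _
  have hadj : CodeFP κ bitE (fun t => adjW t.1.1.1.2.1 t.1.1.1.2.2 t.1.2.1 t.2) := (codeFP_adjW.comp ((hA.pair hm).pair (hv.pair hw))).congr fun _ => rfl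
  have hcw : CodeFP κ bitE (fun t => decide (natAt t.1.1.2 t.2 = t.1.2.2)) := (natEq.comp ((codeFP_natAt.comp (hcol.pair hw)).pair ha)).congr fun _ => rfl
  have hpred : CodeFP κ bitE (fun t => adjW t.1.1.1.2.1 t.1.1.1.2.2 t.1.2.1 t.2 && decide (natAt t.1.1.2 t.2 = t.1.2.2)) := hadj.and hcw
  have hrange : CodeFP (pairE ctxE (pairE natE natE)) (rawE natE) (fun s => List.range s.1.1.1) := urange.comp (fst _ _).fst'.fst'
  have hf := (filter hpred).comp ((CodeFP.id _).pair hrange)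
  exact ((natLength natE).comp hf).congr fun s => rfl

/-- **The count table is typed polynomial time.** [cite: AroraBarakCC2009, §1.3] -/
theorem codeFP_cntTable : CodeFP ctxE (rawE (rawE natE)) (fun s => cntTable s.1.1 s.1.2.1 s.1.2.2 s.2) := by
  -- inner item: context `(ctx, v)`, item `w`
  let κ : (Ctx × ℕ) × ℕ → List Bool := pairE (pairE ctxE natE) natE
  have hctx : CodeFP κ ctxE (fun t => t.1.1) := (fst _ _).fst'
  have hv : CodeFP κ natE (fun t => t.1.2) := (fst _ _).snd'
  have hw : CodeFP κ natE (fun t => t.2) := snd _ _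
  have hcw : CodeFP κ natE (fun t => natAt t.1.1.2 t.2) := (codeFP_natAt.comp (hctx.snd'.pair hw)).congr fun _ => rfl
  have hitem : CodeFP κ natE (fun t => nbrCountL t.1.1.1.1 t.1.1.1.2.1 t.1.1.1.2.2 t.1.1.2 t.1.2 (natAt t.1.1.2 t.2)) :=
    (codeFP_nbrCountL.comp (hctx.pair (hv.pair hcw))).congr fun _ => rfl
  have hn1 : CodeFP (pairE ctxE natE) unE (fun q => q.1.1.1) := (fst _ _).fst'.fst'
  have hr1 : CodeFP (pairE ctxE natE) (rawE natE) (fun q => List.range q.1.1.1) := urange.comp hn1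
  have hrow : CodeFP (pairE ctxE natE) (rawE natE) (fun q => (List.range q.1.1.1).map fun w => nbrCountL q.1.1.1 q.1.1.2.1 q.1.1.2.2 q.1.2 q.2 (natAt q.1.2 w)) :=
    ((map hitem).comp ((CodeFP.id _).pair hr1)).congr fun _ => rfl
  have hn0 : CodeFP ctxE unE (fun s => s.1.1) := (fst _ _).fst'
  have hr0 : CodeFP ctxE (rawE natE) (fun s => List.range s.1.1) := urange.comp hn0
  have htab : CodeFP ctxE (rawE (rawE natE)) (fun s => (List.range s.1.1).map fun v =>
      (List.range s.1.1).map fun w => nbrCountL s.1.1 s.1.2.1 s.1.2.2 s.2 v (natAt s.2 w)) := ((map hrow).comp ((CodeFP.id _).pair hr0)).congr fun _ => rfl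
  exact htab.congr fun s => rfl

/-- Table lookups are typed polynomial time. [folklore] -/
theorem codeFP_tAt : CodeFP (pairE (rawE (rawE natE)) (pairE natE natE)) natE (fun p => tAt p.1 p.2.1 p.2.2) :=
  (codeFP_natAt.comp (((rawGetD (rawE natE) (d := []) rfl).comp ((fst _ _).pair (snd _ _).fst')).pair (snd _ _).snd')).congr fun _ => rfl

/-- The context of the key tests: `((ctx, table), (v, u))`. [folklore] -/
abbrev KCtx : Type := (Ctx × List (List ℕ)) × (ℕ × ℕ)

/-- Its code. [folklore] -/
abbrev kctxE : KCtx → List Bool := pairE (pairE ctxE (rawE (rawE natE))) (pairE natE natE)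

/-- **The staged key test is typed polynomial time.** [cite: AroraBarakCC2009, §1.3] -/
theorem codeFP_keyLTT : CodeFP kctxE bitE (fun t => keyLTT t.1.1.1.1 t.1.1.2 t.1.2 t.2.1 t.2.2) := by
  -- innermost: context `((kctx, w), w')`
  let κ₂ : (KCtx × ℕ) × ℕ → List Bool := pairE (pairE kctxE natE) natE
  have k2 : CodeFP κ₂ kctxE (fun t => t.1.1) := (fst _ _).fst'
  have w2 : CodeFP κ₂ natE (fun t => t.1.2) := (fst _ _).snd'
  have w2' : CodeFP κ₂ natE (fun t => t.2) := snd _ _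
  have col2 : CodeFP κ₂ (rawE natE) (fun t => t.1.1.1.1.2) := k2.fst'.fst'.snd'
  have T2 : CodeFP κ₂ (rawE (rawE natE)) (fun t => t.1.1.1.2) := k2.fst'.snd'
  have v2 : CodeFP κ₂ natE (fun t => t.1.1.2.1) := k2.snd'.fst'
  have u2 : CodeFP κ₂ natE (fun t => t.1.1.2.2) := k2.snd'.snd'
  have hc1 : CodeFP κ₂ bitE (fun t => decide (natAt t.1.1.1.1.2 t.2 < natAt t.1.1.1.1.2 t.1.2)) :=
    (natLt.comp ((codeFP_natAt.comp (col2.pair w2')).pair (codeFP_natAt.comp (col2.pair w2)))).congr fun _ => rfl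
  have hc2 : CodeFP κ₂ bitE (fun t => decide (tAt t.1.1.1.2 t.1.1.2.1 t.2 = tAt t.1.1.1.2 t.1.1.2.2 t.2)) :=
    (natEq.comp ((codeFP_tAt.comp (T2.pair (v2.pair w2'))).pair (codeFP_tAt.comp (T2.pair (u2.pair w2'))))).congr fun _ => rfl
  have hinner : CodeFP κ₂ bitE (fun t => !decide (natAt t.1.1.1.1.2 t.2 < natAt t.1.1.1.1.2 t.1.2) || decide (tAt t.1.1.1.2 t.1.1.2.1 t.2 = tAt t.1.1.1.2 t.1.1.2.2 t.2)) :=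
    hc1.not.or hc2
  -- middle: context `(kctx, w)`
  let κ₁ : KCtx × ℕ → List Bool := pairE kctxE natE
  have k1 : CodeFP κ₁ kctxE (fun t => t.1) := fst _ _
  have w1 : CodeFP κ₁ natE (fun t => t.2) := snd _ _
  have T1 : CodeFP κ₁ (rawE (rawE natE)) (fun t => t.1.1.2) := k1.fst'.snd'
  have v1 : CodeFP κ₁ natE (fun t => t.1.2.1) := k1.snd'.fst'
  have u1 : CodeFP κ₁ natE (fun t => t.1.2.2) := k1.snd'.snd'
  have n1 : CodeFP κ₁ unE (fun t => t.1.1.1.1.1) := k1.fst'.fst'.fst'.fst'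
  have hlt : CodeFP κ₁ bitE (fun t => decide (tAt t.1.1.2 t.1.2.1 t.2 < tAt t.1.1.2 t.1.2.2 t.2)) :=
    (natLt.comp ((codeFP_tAt.comp (T1.pair (v1.pair w1))).pair (codeFP_tAt.comp (T1.pair (u1.pair w1))))).congr fun _ => rfl
  have hr1 : CodeFP κ₁ (rawE natE) (fun t => List.range t.1.1.1.1.1) := urange.comp n1
  have hall := (all hinner).comp ((CodeFP.id _).pair hr1)
  have hmid : CodeFP κ₁ bitE (fun t => decide (tAt t.1.1.2 t.1.2.1 t.2 < tAt t.1.1.2 t.1.2.2 t.2) &&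
      (List.range t.1.1.1.1.1).all fun w' => !decide (natAt t.1.1.1.2 w' < natAt t.1.1.1.2 t.2) || decide (tAt t.1.1.2 t.1.2.1 w' = tAt t.1.1.2 t.1.2.2 w')) :=
    (hlt.and hall).congr fun t => rfl
  -- outer: context `kctx`
  have n0 : CodeFP kctxE unE (fun t => t.1.1.1.1) := (fst _ _).fst'.fst'.fst'
  have col0 : CodeFP kctxE (rawE natE) (fun t => t.1.1.2) := (fst _ _).fst'.snd'
  have v0 : CodeFP kctxE natE (fun t => t.2.1) := (snd _ _).fst'
  have u0 : CodeFP kctxE natE (fun t => t.2.2) := (snd _ _).snd'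
  have hr0 : CodeFP kctxE (rawE natE) (fun t => List.range t.1.1.1.1) := urange.comp n0
  have hany := (any hmid).comp ((CodeFP.id _).pair hr0)
  have hprof : CodeFP kctxE bitE (fun t => profLTT t.1.1.1.1 t.1.1.2 t.1.2 t.2.1 t.2.2) := hany.congr fun t => rfl
  have hcv : CodeFP kctxE natE (fun t => natAt t.1.1.2 t.2.1) := (codeFP_natAt.comp (col0.pair v0)).congr fun _ => rfl
  have hcu : CodeFP kctxE natE (fun t => natAt t.1.1.2 t.2.2) := (codeFP_natAt.comp (col0.pair u0)).congr fun _ => rfl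
  exact ((natLt.comp (hcv.pair hcu)).or ((natEq.comp (hcv.pair hcu)).and hprof)).congr fun t => rfl

/-- **The staged round is typed polynomial time**: input `(ctx, table)`. [cite: AroraBarakCC2009, §1.3] -/
theorem codeFP_ocrStepT : CodeFP (pairE ctxE (rawE (rawE natE))) (rawE natE) (fun s => ocrStepT s.1.1.1 s.1.2 s.2) := by
  -- item: context `((ctx, T), u)`, filter over `v`
  let κ : (Ctx × List (List ℕ)) × ℕ → List Bool := pairE (pairE ctxE (rawE (rawE natE))) natE
  have hpred : CodeFP (pairE κ natE) bitE (fun t => keyLTT t.1.1.1.1.1 t.1.1.1.2 t.1.1.2 t.2 t.1.2) :=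
    (codeFP_keyLTT.comp ((fst _ _).fst'.pair ((snd _ _).pair (fst _ _).snd'))).congr fun _ => rfl
  have n1 : CodeFP κ unE (fun t => t.1.1.1.1) := (fst _ _).fst'.fst'.fst'
  have hr1 : CodeFP κ (rawE natE) (fun t => List.range t.1.1.1.1) := urange.comp n1
  have hcount : CodeFP κ natE (fun t => ((List.range t.1.1.1.1).filter fun v => keyLTT t.1.1.1.1 t.1.1.2 t.1.2 v t.2).length) :=
    ((natLength natE).comp ((filter hpred).comp ((CodeFP.id _).pair hr1))).congr fun t => rfl
  have n0 : CodeFP (pairE ctxE (rawE (rawE natE))) unE (fun s => s.1.1.1) := (fst _ _).fst'.fst'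
  have hr0 : CodeFP (pairE ctxE (rawE (rawE natE))) (rawE natE) (fun s => List.range s.1.1.1) := urange.comp n0
  exact ((map hcount).comp ((CodeFP.id _).pair hr0)).congr fun s => rfl

/-- **One round of ordered colour refinement on lists is typed polynomial time.** [cite: AroraBarakCC2009, §1.3] -/
theorem codeFP_ocrStepL : CodeFP ctxE (rawE natE) (fun s => ocrStepL s.1.1 s.1.2.1 s.1.2.2 s.2) :=
  (codeFP_ocrStepT.comp ((CodeFP.id _).pair codeFP_cntTable)).congr fun _ => ocrStepT_cntTable _ _ _ _

end CGProg

end Literature.Computability.Complexity
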